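import Summits.BirchSwinnertonDyer.Rank1Residual.AdditivePotMult.QuadraticBaseChangeOddTamagawaUnits
import Summits.BirchSwinnertonDyer.Rank1Residual.AdditivePotMult.QuadraticBaseChangeOddTamagawaAssembly
import HarnessLib

/-!
# The odd Tamagawa identity of Milne's quadratic BSD quotient for curves semistable away from the
# potentially multiplicative ramified primes (row T-MIL-ODD, FILE C-3d — the END of stage C;
# seat n1011-p01 GEN 6)

HONEST FRAMING (cell `b2b-bsdres`, run/shared/lean/b2b/bsd-rank1-residual/, verbatim in every
file): the goal of the cell is to DELETE the COMBINATION-SHAPED residual classes of the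
Birch–Swinnerton-Dyer formula for ALL analytic-rank `≤ 1` elliptic curves over `ℚ` — "full BSD
formula for every rank `≤ 1` curve in class `C`" assembled STRICTLY from published theorems — so
that the rank-`≤ 1` remainder becomes exactly the CONSTRUCTION-SHAPED classes, which are TYPED
(missing-input `Prop`s), NOT attempted. This is not "finishing BSD". Sub-classes X3♯(M) / X4(M)
(additive, potentially multiplicative prime; base-change-and-descend): a RESEARCH ROUTE; they stay
CONSTRUCTION-SHAPED; nothing is booked by this file; no mark / label moved. THEOREMS ONLY: no
definition, no named fact, no `sorry`.

## What (row T-MIL-ODD, `cells/n1011/skel/T-MIL-ODD.md` §0, §2 "STAGE C", §6)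

**THE ODD PART OF MILNE'S QUADRATIC BSD-QUOTIENT IDENTITY, AS A KERNEL THEOREM, on the population
S₁.** For: `W/ℚ` globally minimal elliptic; `K` a quadratic field (`[K:ℚ] = 2`) with `d_K` ODD and
SQUAREFREE (all odd fundamental discriminants; e.g. `K = ℚ(√p*)`); `W_d = C_d • W^{(d_K)}` and
`W' = C' • W_K` globally minimal models; and the POPULATION HYPOTHESIS `hS`: at every finite place
`v` of `ℚ`, `W` has good reduction, or multiplicative reduction (at `v = 2` only if `2` splits in
`K`, `d_K ≡ 1 mod 8`), or `v ∣ d_K` and `W_d` is multiplicative at `v` (i.e. `v` is a POTENTIALLY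
MULTIPLICATIVE ramified prime — the additive prime of the X3♯(M)/X4(M) descent with `K = ℚ(√p*)`);
then for EVERY ODD prime `p`:

  `v_p(|N_{K/ℚ}(C'.u)| · ∏_w c_w(W')) = v_p(|C_d.u| · ∏_v c_v(W) · ∏_v c_v(W_d))`

(`padicValRat_norm_mul_tamagawaProduct_eq_of_semistable`) — LITERALLY the body of hypothesis `hodd`
of the tree's `WeierstrassCurve.bsdRHS_baseChange_quadratic_of_padicValRat`
(`Literature/…/BSDQuadraticDescentTorsionOddPartProofs.lean`) for this datum, and the
Tamagawa/unit content at odd `p` of the named facts A65/A73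
`Milne1972.bsdQuotient_baseChange_quadratic[_anyModel]` (the `hWR` binder of every X3♯(M)/X4(M)
descent theorem) on S₁. In particular S₁ contains every X3♯(M)/X4(M) curve (`K = ℚ(√p*)`, `W`
additive potentially multiplicative at `p` with `W_K` multiplicative) whose other bad primes are
multiplicative (with the `d_K mod 8` proviso at `2`), i.e. conductor `p²·N'`, `N'` squarefree prime
to `p`.

## How

The assembly schema (FILE C-2 `padicValRat_norm_mul_tamagawaProduct_eq_of_local_baseChange`)
reduces the identity to the per-place identities (T) and, at `p`, (P) = (T) + the `δ`-identity
(D) `Σ_{w∣p} f(w|p)·ord_w(C'.u) = ord_p(C_d.u)`. (T) is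
`sum_fibre_padicValNat_localTamagawaNumber_of_semistable`: by the tree's
`placesOver_trichotomy_of_finrank_eq_two` and the dictionary of FILE C-3a, a place is split (FILE
C-3b `…_of_split`, any reduction), inert (`ℓ ∤ d_K`: good — `c = 1` everywhere, at `ℓ = 2` by the
`twistModel` lemma of FILE C-3c —, or multiplicative, C-3b `…_of_mult_of_inert`; `v ∣ d_K` is
excluded by Dedekind), or ramified (`ℓ ∣ d_K`, odd since `d_K` is odd, `ℓ ∥ d_K` since squarefree:
good / multiplicative / potentially multiplicative, C-3b). (D) is
`sum_fibre_inertiaDeg_mul_ord_u_eq_of_semistable`: every unit term vanishes (FILE C-3c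
`valuation_u_eq_one_of_good/mult`, `valuation_u_twist_eq_one_of_*`) except at a potentially
multiplicative ramified `p`, where both sides equal `1` (`δ_w = δ_{d,p} = 1`, A-4K/A-4M). In print
this is the odd part of Milne, Invent. Math. 17 (1972) §1 Thm. 1 (local indices of
`E × E^{(D)} → Res_{K/ℚ}E_K`, *ADT* I.7.3), place by place as in Kramer, Trans. AMS 264 (1981) §2
Props. 1–3; nothing of Milne's proof is used.

HONEST LIMITS: `hodd` itself quantifies over ALL `W` and ALL quadratic `K` — this file discharges it
on S₁ × {`d_K` odd squarefree} only; NOT covered: additive places of `W` unramified in `K` (row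
A-tail), the multiplicative place `2` inert in `K` ((M4) at `2`), even `d_K`, and the IV/IV* places
at `p = 3` (row T-MIL-B). No consumer's binder is changed by this file (the A65-free odd-`p` descent
twin of `AdditivePotMult/Descent.bsdp_of_pPartOver_of_bsdp_twist` is the next file of the row).
Closes no class; moves no mark.
-/

noncomputable section

open scoped Classical NumberField

open WeierstrassCurve NumberField IsDedekindDomain Rat.HeightOneSpectrum WithZero
  Literature.NumberTheory.EllipticCurves
  Summit.BirchSwinnertonDyer.Rank1Residual.Additive

namespace Summit.BirchSwinnertonDyer.Rank1Residual.AdditivePotMult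

/-! ## §1 Fibre bookkeeping -/

section Fibre

variable {K : Type} [Field K] [NumberField K] {v : HeightOneSpectrum (𝓞 ℚ)}

/-- The single place of a singleton fibre lies above `v`. [folklore] -/
theorem under_eq_of_fibre_eq_singleton {w : HeightOneSpectrum (𝓞 K)}
    (hset : {w' : HeightOneSpectrum (𝓞 K) | w'.under (𝓞 ℚ) = v} = {w}) : w.under (𝓞 ℚ) = v := by
  have h : w ∈ ({w} : Set (HeightOneSpectrum (𝓞 K))) := Set.mem_singleton _
  rwa [← hset] at h

/-- The fibre `Finset` of a singleton fibre. [folklore] -/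
theorem toFinset_eq_singleton_of_fibre {w : HeightOneSpectrum (𝓞 K)}
    (hset : {w' : HeightOneSpectrum (𝓞 K) | w'.under (𝓞 ℚ) = v} = {w}) :
    (HeightOneSpectrum.finite_setOf_under_eq_of_numberField (K := K) v).toFinset = {w} := by
  ext w'
  rw [Set.Finite.mem_toFinset, hset]
  simp

/-- The fibre `Finset` of a split fibre. [folklore] -/
theorem toFinset_eq_pair_of_fibre {w₁ w₂ : HeightOneSpectrum (𝓞 K)}
    (hset : {w : HeightOneSpectrum (𝓞 K) | w.under (𝓞 ℚ) = v} = {w₁, w₂}) :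
    (HeightOneSpectrum.finite_setOf_under_eq_of_numberField (K := K) v).toFinset = {w₁, w₂} := by
  ext w
  rw [Set.Finite.mem_toFinset, hset]
  simp

end Fibre

/-! ## §2 The END: (ODD-TAM)@p for `W` semistable away from the potentially multiplicative ramified
primes, `d_K` odd squarefree, every odd `p` -/

section End

variable (W : WeierstrassCurve ℚ) [W.IsElliptic] [W.IsGloballyMinimal]
  (K : Type) [Field K] [NumberField K] (Wd : WeierstrassCurve ℚ) [Wd.IsElliptic] [Wd.IsGloballyMinimal]
  (W' : WeierstrassCurve K) [W'.IsGloballyMinimal]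

/-- **(T) at EVERY place, on the population S₁.** For `W/ℚ` globally minimal, `[K:ℚ] = 2` with `d_K`
odd squarefree, `W_d = C_d • W^{(d_K)}` globally minimal, the population hypothesis `hS` (module
docstring) and `p` odd: `Σ_{w ∣ v} v_p(c_w(W_K)) = v_p(c_v(W)) + v_p(c_v(W_d))` at every finite place
`v` of `ℚ` — by the trichotomy split / inert / ramified (tree `placesOver_trichotomy_of_finrank_eq_two`),
the dictionary of FILE C-3a (inert ⇒ `ℓ ∤ d_K`; ramified ⇒ `ℓ ∣ d_K`, so `ℓ` odd and `ℓ ∥ d_K`;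
`d_K ≡ 1 mod 8` ⇒ `2` split), and the per-case identities of FILES C-3b/C-3c.
[cite: Milne1972ArithmeticAV, §1 Thm. 1 and §2 (through DokchitserDokchitserAnnals2010, §2.1, proof of Thm. 8)] -/
theorem sum_fibre_padicValNat_localTamagawaNumber_of_semistable (h2 : Module.finrank ℚ K = 2)
    (hdodd : Odd (NumberField.discr K)) (hdsq : Squarefree (NumberField.discr K))
    {Cd : VariableChange ℚ} (hWd : Cd • W.quadraticTwist (NumberField.discr K : ℚ) = Wd)
    (hS : ∀ v : HeightOneSpectrum (𝓞 ℚ), W.HasGoodReductionAt v ∨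
      (W.HasMultiplicativeReductionAt v ∧ ((primesEquiv v : ℕ) ≠ 2 ∨ NumberField.discr K % 8 = 1)) ∨
      (((primesEquiv v : ℕ) : ℤ) ∣ NumberField.discr K ∧ Wd.HasMultiplicativeReductionAt v))
    (p : ℕ) [Fact p.Prime] (hp2 : p ≠ 2) (v : HeightOneSpectrum (𝓞 ℚ)) :
    ∑ w ∈ (HeightOneSpectrum.finite_setOf_under_eq_of_numberField (K := K) v).toFinset,
        padicValNat p (((W.baseChange K).baseChange (w.adicCompletion K)).localTamagawaNumber
          (w.adicCompletionIntegers K)) =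
      padicValNat p ((W.baseChange (v.adicCompletion ℚ)).localTamagawaNumber
          (v.adicCompletionIntegers ℚ)) +
        padicValNat p ((Wd.baseChange (v.adicCompletion ℚ)).localTamagawaNumber
          (v.adicCompletionIntegers ℚ)) := by
  set d : ℤ := NumberField.discr K with hddef
  have hd0 : d ≠ 0 := NumberField.discr_ne_zero K
  have hd4 : d % 4 = 1 := by
    rcases Literature.NumberTheory.QuadraticFields.Quadratic.discr_emod_four h2 with h | h
    · exfalso
      obtain ⟨k, hk⟩ := hdodd
      omega
    · exact h
  have hℓ : ((primesEquiv v : ℕ)).Prime := (primesEquiv v).2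
  have hd2 : ¬ ((primesEquiv v : ℕ) : ℤ) ^ 2 ∣ d := not_sq_dvd_of_squarefree hdsq _ hℓ
  rcases placesOver_trichotomy_of_finrank_eq_two K h2 v with
    ⟨w₁, w₂, hne, hset, hef⟩ | ⟨w, hset, he, hf⟩ | ⟨w, hset, he, hf⟩
  · -- split
    exact sum_fibre_padicValNat_localTamagawaNumber_of_split W Wd p v h2 hWd hne hset hef
  · -- inert: `ℓ ∤ d`
    have hnd := not_dvd_discr_of_fibre_eq_singleton K v hset he
    rcases hS v with hgood | ⟨hmult, h28⟩ | ⟨hdvd, -⟩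
    · rw [sum_fibre_padicValNat_localTamagawaNumber_eq_zero_of_good W p v hgood,
        padicValNat_localTamagawaNumber_eq_zero_of_good W p v hgood, zero_add]
      by_cases hv2 : (primesEquiv v : ℕ) = 2
      · rw [localTamagawaNumber_twist_eq_one_of_good_of_emod_four W v hd4 hnd hgood hWd,
          padicValNat_one_right]
      · exact (padicValNat_localTamagawaNumber_twist_eq_zero_of_good_of_odd W Wd p v hv2 hd0 hd2 hWd
          hgood hp2).symm
    · have hv2 : (primesEquiv v : ℕ) ≠ 2 := by
        rcases h28 with h | h8
        · exact h
        · intro hv2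
          have hsplit := (Literature.NumberTheory.QuadraticFields.Quadratic.ncard_primesOver_two_eq_two_iff
            h2).mpr h8
          have h1 := ncard_primesOver_eq_one_of_fibre_singleton K v hset
          rw [hv2] at h1
          simp only [Nat.cast_ofNat] at h1
          rw [h1] at hsplit
          exact absurd hsplit (by decide)
      exact sum_fibre_padicValNat_localTamagawaNumber_of_mult_of_inert W Wd p v h2 hWd hv2 hmult hset
        he hf hp2
    · exact absurd hdvd hnd
  · -- ramified: `ℓ ∣ d`, `ℓ` odd, `ℓ ∥ d`
    have hw : w.under (𝓞 ℚ) = v := under_eq_of_fibre_eq_singleton hset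
    have hdvd : ((primesEquiv v : ℕ) : ℤ) ∣ d := natCast_dvd_discr_of_ramificationIdx_eq_two K v hw he
    have hv2 : (primesEquiv v : ℕ) ≠ 2 := by
      intro h2'
      rw [h2'] at hdvd
      obtain ⟨k, hk⟩ := hdodd
      omega
    rcases hS v with hgood | ⟨hmult, -⟩ | ⟨-, hmultd⟩
    · rw [sum_fibre_padicValNat_localTamagawaNumber_eq_zero_of_good W p v hgood,
        padicValNat_localTamagawaNumber_eq_zero_of_good W p v hgood, zero_add]
      exact (padicValNat_localTamagawaNumber_twist_eq_zero_of_good_of_odd W Wd p v hv2 hd0 hd2 hWd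
        hgood hp2).symm
    · exact sum_fibre_padicValNat_localTamagawaNumber_of_mult_of_ramified W Wd p v hd2 hWd hv2 hmult
        hset he hf hdvd hp2
    · exact sum_fibre_padicValNat_localTamagawaNumber_of_potMult_of_ramified W Wd p v h2 hd2 hWd hv2
        hmultd hset he hf hdvd hp2

/-- **(D) the `δ`-identity at an odd place `v₀`, on the population S₁**:
`Σ_{w ∣ v₀} f(w|v₀)·ord_w(C'.u) = ord_{v₀}(C_d.u)` (`ord = −log ∘ valuation`) for the globally minimal
models `W' = C' • W_K`, `W_d = C_d • W^{(d_K)}` — all terms vanish (FILE C-3c) unless `v₀ ∣ d_K` is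
potentially multiplicative, where `f = 1`, `ord_w(C'.u) = 1 = ord_{v₀}(C_d.u)` (A-4K, A-4M).
[cite: SilvermanAEC2009, VII.1 Prop. 1.3(a)–(b) and VIII.8] -/
theorem sum_fibre_inertiaDeg_mul_ord_u_eq_of_semistable (h2 : Module.finrank ℚ K = 2)
    (hdsq : Squarefree (NumberField.discr K))
    {Cd : VariableChange ℚ} (hWd : Cd • W.quadraticTwist (NumberField.discr K : ℚ) = Wd)
    {C' : VariableChange K} (hW' : C' • W.baseChange K = W')
    (hS : ∀ v : HeightOneSpectrum (𝓞 ℚ), W.HasGoodReductionAt v ∨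
      (W.HasMultiplicativeReductionAt v ∧ ((primesEquiv v : ℕ) ≠ 2 ∨ NumberField.discr K % 8 = 1)) ∨
      (((primesEquiv v : ℕ) : ℤ) ∣ NumberField.discr K ∧ Wd.HasMultiplicativeReductionAt v))
    (v₀ : HeightOneSpectrum (𝓞 ℚ)) (hv₀2 : (primesEquiv v₀ : ℕ) ≠ 2) :
    ∑ w ∈ (HeightOneSpectrum.finite_setOf_under_eq_of_numberField (K := K) v₀).toFinset,
        (w.asIdeal.inertiaDeg (𝓞 ℚ) : ℤ) * (-log (w.valuation K (C'.u : K))) =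
      -log (v₀.valuation ℚ (Cd.u : ℚ)) := by
  set d : ℤ := NumberField.discr K with hddef
  have hd0 : d ≠ 0 := NumberField.discr_ne_zero K
  have hℓ : ((primesEquiv v₀ : ℕ)).Prime := (primesEquiv v₀).2
  have hd2 : ¬ ((primesEquiv v₀ : ℕ) : ℤ) ^ 2 ∣ d := not_sq_dvd_of_squarefree hdsq _ hℓ
  have hmin : ∀ w : HeightOneSpectrum (𝓞 K), W'.IsMinimalAt w := fun w =>
    IsGloballyMinimal.isMinimal (W := W') w
  rcases placesOver_trichotomy_of_finrank_eq_two K h2 v₀ with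
    ⟨w₁, w₂, hne, hset, hef⟩ | ⟨w, hset, he, hf⟩ | ⟨w, hset, he, hf⟩
  · -- split: all units
    have hw₁ : w₁.under (𝓞 ℚ) = v₀ := by
      have h : w₁ ∈ ({w₁, w₂} : Set (HeightOneSpectrum (𝓞 K))) := Set.mem_insert _ _
      rwa [← hset] at h
    have hw₂ : w₂.under (𝓞 ℚ) = v₀ := by
      have h : w₂ ∈ ({w₁, w₂} : Set (HeightOneSpectrum (𝓞 K))) :=
        Set.mem_insert_of_mem _ (Set.mem_singleton _)
      rwa [← hset] at h
    obtain ⟨hnd, -⟩ := not_dvd_and_isSquare_discr_of_split v₀ h2 hv₀2 hne hset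
    rw [toFinset_eq_pair_of_fibre hset, Finset.sum_pair hne]
    rcases hS v₀ with hgood | ⟨hmult, -⟩ | ⟨hdvd, -⟩
    · rw [valuation_u_eq_one_of_good W w₁ hw₁ hW' (hmin w₁) hgood,
        valuation_u_eq_one_of_good W w₂ hw₂ hW' (hmin w₂) hgood,
        valuation_u_twist_eq_one_of_not_dvd_of_good W Wd v₀ hv₀2 hd0 hnd hWd hgood, log_one]
      simp
    · rw [valuation_u_eq_one_of_mult W w₁ hw₁ hW' (hmin w₁) hmult,
        valuation_u_eq_one_of_mult W w₂ hw₂ hW' (hmin w₂) hmult,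
        valuation_u_twist_eq_one_of_not_dvd_of_mult W Wd v₀ hv₀2 hd0 hnd hWd hmult, log_one]
      simp
    · exact absurd hdvd hnd
  · -- inert: all units
    have hw : w.under (𝓞 ℚ) = v₀ := under_eq_of_fibre_eq_singleton hset
    have hnd := not_dvd_discr_of_fibre_eq_singleton K v₀ hset he
    rw [toFinset_eq_singleton_of_fibre hset, Finset.sum_singleton]
    rcases hS v₀ with hgood | ⟨hmult, -⟩ | ⟨hdvd, -⟩
    · rw [valuation_u_eq_one_of_good W w hw hW' (hmin w) hgood,
        valuation_u_twist_eq_one_of_not_dvd_of_good W Wd v₀ hv₀2 hd0 hnd hWd hgood, log_one]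
      simp
    · rw [valuation_u_eq_one_of_mult W w hw hW' (hmin w) hmult,
        valuation_u_twist_eq_one_of_not_dvd_of_mult W Wd v₀ hv₀2 hd0 hnd hWd hmult, log_one]
      simp
    · exact absurd hdvd hnd
  · -- ramified: units unless potentially multiplicative, where both sides are `1`
    have hw : w.under (𝓞 ℚ) = v₀ := under_eq_of_fibre_eq_singleton hset
    have hdvd : ((primesEquiv v₀ : ℕ) : ℤ) ∣ d := natCast_dvd_discr_of_ramificationIdx_eq_two K v₀ hw he
    rw [toFinset_eq_singleton_of_fibre hset, Finset.sum_singleton, hf]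
    rcases hS v₀ with hgood | ⟨hmult, -⟩ | ⟨-, hmultd⟩
    · rw [valuation_u_eq_one_of_good W w hw hW' (hmin w) hgood,
        valuation_u_twist_eq_one_of_dvd_of_good W Wd v₀ hv₀2 hdvd hd2 hWd hgood, log_one]
      simp
    · rw [valuation_u_eq_one_of_mult W w hw hW' (hmin w) hmult,
        valuation_u_twist_eq_one_of_dvd_of_mult W Wd v₀ hv₀2 hdvd hd2 hWd hmult, log_one]
      simp
    · obtain ⟨θ, hθ0, hθ⟩ := exists_sq_eq_discr h2
      rw [log_valuation_u_eq_neg_one_of_potMult W w Wd hv₀2 hdvd hd2 hWd hmultd hθ0 hθ hw he hW'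
          (hmin w),
        log_valuation_u_twist_eq_neg_one_of_potMult W Wd v₀ hv₀2 hdvd hd2 hWd hmultd]
      simp

/-- **THE ODD TAMAGAWA IDENTITY OF MILNE'S QUADRATIC BSD QUOTIENT ON S₁ (every odd `p`).** For
`W/ℚ` globally minimal elliptic, `K` quadratic with `d_K` odd and squarefree, globally minimal models
`W_d = C_d • W^{(d_K)}` over `ℚ` and `W' = C' • W_K` over `K`, and the population hypothesis `hS` —
at every place `W` is good, or multiplicative (at `2` only with `d_K ≡ 1 mod 8`), or the place
divides `d_K` and `W_d` is multiplicative there (potentially multiplicative ramified) —, for every odd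
prime `p`: `v_p(|N_{K/ℚ}(C'.u)| · ∏_w c_w(W')) = v_p(|C_d.u| · ∏_v c_v(W) · ∏_v c_v(W_d))`, the body
of `hodd` in the tree's `bsdRHS_baseChange_quadratic_of_padicValRat`. Assembly schema (FILE C-2) fed
with (T) (`sum_fibre_padicValNat_localTamagawaNumber_of_semistable`) and (P) = (T) + (D)
(`sum_fibre_inertiaDeg_mul_ord_u_eq_of_semistable`). HONEST LIMITS in the module docstring.
[cite: Milne1972ArithmeticAV, §1 Thm. 1 and §2 (through DokchitserDokchitserAnnals2010, §2.1, proof of Thm. 8)] -/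
theorem padicValRat_norm_mul_tamagawaProduct_eq_of_semistable (h2 : Module.finrank ℚ K = 2)
    (hdodd : Odd (NumberField.discr K)) (hdsq : Squarefree (NumberField.discr K))
    {Cd : VariableChange ℚ} (hWd : Cd • W.quadraticTwist (NumberField.discr K : ℚ) = Wd)
    {C' : VariableChange K} (hW' : C' • W.baseChange K = W')
    (hS : ∀ v : HeightOneSpectrum (𝓞 ℚ), W.HasGoodReductionAt v ∨
      (W.HasMultiplicativeReductionAt v ∧ ((primesEquiv v : ℕ) ≠ 2 ∨ NumberField.discr K % 8 = 1)) ∨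
      (((primesEquiv v : ℕ) : ℤ) ∣ NumberField.discr K ∧ Wd.HasMultiplicativeReductionAt v))
    (p : ℕ) [hp : Fact p.Prime] (hp2 : p ≠ 2) :
    padicValRat p (|Algebra.norm ℚ (C'.u : K)| * W'.tamagawaProduct : ℚ) =
      padicValRat p (|(Cd.u : ℚ)| * (W.tamagawaProduct * Wd.tamagawaProduct) : ℚ) := by
  set v₀ : HeightOneSpectrum (𝓞 ℚ) := (primesEquiv (R := 𝓞 ℚ)).symm ⟨p, hp.out⟩ with hv₀def
  have hv₀ : (primesEquiv v₀ : ℕ) = p := by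
    rw [hv₀def, Equiv.apply_symm_apply]
  have hv₀2 : (primesEquiv v₀ : ℕ) ≠ 2 := by rw [hv₀]; exact hp2
  have hu' : (C'.u : K) ≠ 0 := Units.ne_zero _
  have hud : (Cd.u : ℚ) ≠ 0 := Units.ne_zero _
  have hT := sum_fibre_padicValNat_localTamagawaNumber_of_semistable W K Wd h2 hdodd hdsq hWd hS p hp2
  have hD := sum_fibre_inertiaDeg_mul_ord_u_eq_of_semistable W K Wd W' h2 hdsq hWd hW' hS v₀ hv₀2
  refine padicValRat_norm_mul_tamagawaProduct_eq_of_local_baseChange W Wd W' hW' hu' hud p v₀ hv₀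
    (fun v _ => hT v) ?_
  rw [Finset.sum_add_distrib, hD, ← Nat.cast_sum, hT v₀, Nat.cast_add]

end End

end Summit.BirchSwinnertonDyer.Rank1Residual.AdditivePotMult

end
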